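import Summits.CriticalPhenomena.PercolationContinuityZ3.Theorems.PercNearOneGluingNoHeavyQuantGatedSliceMixLawQKCellsC
import Summits.CriticalPhenomena.PercolationContinuityZ3.Theorems.PercNearOneGluingNoHeavyQuantGatedSliceMixLawQCellQ4OfQK
import Summits.CriticalPhenomena.PercolationContinuityZ3.Theorems.PercNearOneGluingNoHeavyQuantGatedSliceMixLawQCellQHOfQK
import Summits.CriticalPhenomena.PercolationContinuityZ3.Theorems.PercNearOneGluingNoHeavyQuantGatedSliceMixLawRegimeBTopBelowCell
import Summits.CriticalPhenomena.PercolationContinuityZ3.Theorems.PercNearOneGluingNoHeavyQuantWindowMixOfMixLaw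
import HarnessLib

/-!
# QUANT lane R8, T-DEC, leg (III), blob case: THE NODE `GatedSliceMixLaw'` HOLDS, hence CW (`WindowMixDEC`) — assembly

builds on p205010 (kernel theorem, internal audit signed; external expert review pending)

Support file (`--supports stmt-CriticalPhenomena-4575`), QUANT lane, LEAD seat prim-quant-lead (gen 36), rung R8 of
`run/shared/lean/prim/quant/LADDER.md`.  Theorems only, standard axioms, no sorries, no definitions.  Three lines of assembly over: the cell list
and regimes C1–C4 (typer g29/g30), regime A / A5 (lead g32–g33, arm-3 g116), regime B (census-2 g60/g61: B-G, PDear/PCheap with arm-2 g36 / arm-3 g116,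
B-M, BTopBelow, BTwin with arm-3 g120 and lead g34; assembly `gatedSliceMixLaw'_of_Qcells`, p369789), the Q-alone cells (arm-1 g39–g41: every class
theorem incl. the seven-certificate `qk_Ib_lh`, and the cell-QK assembly `mixLawCellQK_holds`, `…QKCellsC` p371264; lead g36: the reductions `mixLawCellQ4_of_QK` p372526,
`mixLawCellQH_of_QK` p372567), and lead g31's
`windowMixDEC_of_mixLaw'` (CW ⟸ the node).

* **`LawDec.gatedSliceMixLaw'_holds : GatedSliceMixLaw'`.**
* **`LawDec.windowMixDEC_holds : WindowMixDEC`** — CW, the window form of the blob gate step: `SDECUpTo` is closed under slicing by any heavy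
  blob (`sdecUpTo_slice_of_windowMix` / `sdecUpTo_slice_blob_of_window`), i.e. the blob case of leg (III) of `SingleGateConvClosed`.
HONEST STATUS: `GateMove` / `SingleGateConvClosed` still need the light residue (cell L3b, arm-2) and the non-AD3⁺ corner; `TreeDEC`, `FarTreeRow`
OPEN; RATE class log\* / honest sentence unchanged.

[this work] (assembly only; credits above, this lane).  The gluing rows served [cite: KozmaNitzan2024, Conjecture 3 (p. 15)]; product measure
[cite: Grimmett1999, §1.3 p. 10].
-/

noncomputable section

namespace Summit.CriticalPhenomena.PercolationContinuityZ3.Theorems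
namespace Quant
namespace LawDec

/-- **THE NODE HOLDS: `GatedSliceMixLaw'`** — census-2 g61's assembly with cells Q4 and QH discharged through cell QK (lead g36) and cell QK proved (arm-1 g41). [this work] -/
theorem gatedSliceMixLaw'_holds : GatedSliceMixLaw' :=
  gatedSliceMixLaw'_of_Qcells (mixLawCellQ4_of_QK mixLawCellQK_holds) (mixLawCellQH_of_QK mixLawCellQK_holds) mixLawCellQK_holds

/-- **CW HOLDS: `WindowMixDEC`** (lead g31's reduction `windowMixDEC_of_mixLaw'`). [this work] -/
theorem windowMixDEC_holds : WindowMixDEC :=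
  windowMixDEC_of_mixLaw' gatedSliceMixLaw'_holds

end LawDec
end Quant
end Summit.CriticalPhenomena.PercolationContinuityZ3.Theorems
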